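/-
Copyright: b2b-lace packet (carver, gen 53).  [FvdH17] §4.2 (4.17) for the repulsive SQUARE whose FIRST line is an
exact bond, `𝓢_{1̲,m₂,m₃,m₄}(v,y,w,x)`: the bond pins the first edge of the coded trail (`r₁ = 1`), the two
remaining junctions stay free, so the (5.41)-type TRIANGLE extraction of [NoBLE17] §5.3.2 applies with line indices
`(1 + m₂, m₃, m₄)`, junctions `(y, w)`, binomial multiplicity and the three remainder slots — node EXL-XSLOT, leaf
XSLOT-S1 of the cell's N76 map (cell `(A^ι)_{0,2}` at its table price).  Proofs only; no named fact; no numeral; no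
dimension.
-/
import Literature.Probability.FitznerVanDerHofstad2017.RepulsiveSquareExtractionIndep
import Literature.Probability.FitznerVanDerHofstad2017.RepulsivePolygonSlots
import Literature.Probability.FitznerVanDerHofstad2017.NobleTriangleLetterSums
import Literature.Probability.FitznerVanDerHofstad2017.NobleRemainderBound
import HarnessLib

/-!
# [FvdH17] (4.17) with an exact first bond (square): the trail-level extraction at binomial multiplicity

For the instance `Letters.perc d p` of the NoBLE letters, the repulsive square letter whose first line is an exact
bond, `𝓢_{1̲,m₂,m₃,m₄}(v,y,w,x) = max_c ℙ_p^{⊗4}({0 –1̲– v}_{c₀} ⊛ {v ←m₂→ y}_{c₁} ⊛ {y ←m₃→ w}_{c₂} ⊛ {w ←m₄→ x}_{c₃})`,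
is bounded by the right-hand side of [NoBLE17] (5.41) at line indices `(1 + m₂, m₃, m₄)` with the junctions read
at `(y, w)`, the position of `v` (`= W(1)`) being determined by the index:

* **Coding** (`exists_trail_of_mem_genDisjOcc_lineEvents₄_eqOne₁`): the exact witness shrunk to its bond, the
  landed square coding `exists_trail_of_mem_genDisjConnN_sqLines` yields ONE bond-self-avoiding word `W` with
  `W(1) = v`, `W(r₂) = y`, `W(r₃) = w`, `W(L) = x`, arcs `[0,1)`, `[1,r₂)`, `[r₂,r₃)`, `[r₃,L)` open on the levels
  `c₀,…,c₃` (`#arc = length` for a trail pins `r₁ = 1`).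
* **Extraction** (`mem_sqBoxes_of_trail_eqOne₁`): cut at `M` as in (5.41) with `(m₁,m₂,m₃) := (1+m₂, m₃, m₄)`: the
  index families `idxExplicitT`, `idxOneTailT`, `idxTwoTailT`, `idxThreeTailT` of the landed triangle extraction,
  the boxes the landed square pieces with the first cut at `1` (`sqPiecesE W 1 r₂ r₃`, `sqPiecesO u 1 r₂ r₃ x`,
  `sqPiecesT2 u₁ 1 r₂ u₄ x w`, `sqPiecesT3 u₁ 1 u₃ u₄ x y w`; the bond stays inside `u₁`, whence the hypothesis
  `m₃ + m₄ + 1 ≤ M`, and the four-tail piece never occurs), so `mem_sqBox*_of_trail` and `piReal_sqBox*_le`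
  (independence across levels × BK within) are used verbatim.
* **Summation** (`piReal_genDisjOcc_lineEvents₄_eqOne₁_le`, `sum_perc_S_eqOne_ge_ge_ge_toReal_le_extraction`,
  `sum3_perc_S_eqOne_ge_ge_ge_toReal_le_slots`, `tsum_tsum_sum_perc_S_eqOne_ge_ge_ge_stepVec_le_ofReal`; cell
  `perc_matAiota_zero_two_le_xslot`): the sum over `v` is fiberwise over the determined position, then the landed
  `sum_sum_le_extractionT_of_pointwise`, `le_extractionT_choose_of_le` and `sum_sum_le_repTriangle_slots` give the
  (5.41) right-hand side with the trail-word counts read through a majorant `N`, i.e. the landed `triangleSlotR` of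
  `NobleTriangleLetterSums` at `(1 + m₂, m₃, m₄)` (the currency of the cell's P⁺ majorant `perc_matAiota_zero_two_le_peel`).

## References
* [FvdH17] R. Fitzner, R. van der Hofstad, Mean-field behavior for nearest-neighbor percolation in `d > 10`,
  Electron. J. Probab. 22 (2017) no. 43; arXiv:1506.07977v2 — §4.2 Def. 4.1, (4.16)–(4.18) and the display after (4.18)
  (v2 pp. 34–36 = EJP p. 33); App. B Table B.4 row (0,2) (p. 74); §5.1 (5.1) (p. 49).
* [NoBLE17] R. Fitzner, R. van der Hofstad, Generalized approach to the non-backtracking lace expansion,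
  Probab. Theory Relat. Fields 169 (2017) 1041–1119 — §5.3.1 (5.35)–(5.38) p. 1097, §5.3.2 (5.41)–(5.42) p. 1098.
-/

noncomputable section

namespace Literature.Probability.FitznerVanDerHofstad2017.NobleBlocks

open _root_.MeasureTheory Finset
open scoped BigOperators ENNReal
open Literature.Probability.LatticeModels Literature.Probability.Percolation
open Literature.Barriers.CriticalPhenomena
open Literature.Probability.FitznerVanDerHofstad2017
open Literature.Probability.FitznerVanDerHofstad2017.NobleBlocks.LenIdx

variable {d : ℕ}

/-! ## A. Coding: the exact first bond is the first edge of the trail -/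

/-- **Coding of a member of `𝓢_{1̲,m₂,m₃,m₄}(v,y,w,x)`.**  If
`ω ∈ {0 –1̲– v}_{c₀} ⊛ {v ←m₂→ y}_{c₁} ⊛ {y ←m₃→ w}_{c₂} ⊛ {w ←m₄→ x}_{c₃}` (lattice configurations), there is ONE
bond-self-avoiding word `W` of length `L` with `W(1) = v`, `W(r₂) = y`, `W(r₃) = w`, `W(L) = x` (`1 + m₂ ≤ r₂`,
`r₂ + m₃ ≤ r₃`, `r₃ + m₄ ≤ L`), the bond `[0,1)` in `ω_{c₀}` and the arcs `[1,r₂)`, `[r₂,r₃)`, `[r₃,L)` open in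
`ω_{c₁}`, `ω_{c₂}`, `ω_{c₃}`: the landed square coding applied to the witness sets, the exact witness shrunk to its bond.
[cite: FitznerVanDerHofstad2017, §4.2 Def. 4.1, (4.17) and the sentence after it (arXiv:1506.07977v2 pp. 35–36 = EJP p. 33)]
[cite: FitznerVanDerHofstad2016NoBLE, §5.3.1 (5.35) PTRF p. 1097] -/
theorem exists_trail_of_mem_genDisjOcc_lineEvents₄_eqOne₁ {k : ℕ} {c : Fin 4 → Fin k}
    {ω : Fin k → BondConfig (Site d)} (hω : ∀ j, ω j ⊆ (zdGraph d).edgeSet) {m₂ m₃ m₄ : ℕ} {v y w x : Site d}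
    (h : ω ∈ genDisjOcc (lineEvents₄ (eq 1) (ge m₂) (ge m₃) (ge m₄) v y w x) c) :
    ∃ (L r₂ r₃ : ℕ) (W : Fin L → Fin d × Bool), IsTrail W ∧ 1 + m₂ ≤ r₂ ∧ r₂ + m₃ ≤ r₃ ∧ r₃ + m₄ ≤ L ∧
      wordPos W 1 = v ∧ wordPos W r₂ = y ∧ wordPos W r₃ = w ∧ wordPos W L = x ∧
      (↑(wordArc W 0 1) : Set (Sym2 (Site d))) ⊆ ω (c 0) ∧
        (↑(wordArc W 1 r₂) : Set (Sym2 (Site d))) ⊆ ω (c 1) ∧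
          (↑(wordArc W r₂ r₃) : Set (Sym2 (Site d))) ⊆ ω (c 2) ∧
            (↑(wordArc W r₃ L) : Set (Sym2 (Site d))) ⊆ ω (c 3) := by
  classical
  obtain ⟨K, hKω, hKA, hdisj⟩ := h
  have hA0 : K 0 ∈ (openConnEq 1 (0 : Site d) v : Set (BondConfig (Site d))) := by
    simpa [lineEvents₄] using hKA 0
  have hA1 : K 1 ∈ (openConnGe m₂ v y : Set (BondConfig (Site d))) := by simpa [lineEvents₄] using hKA 1
  have hA2 : K 2 ∈ (openConnGe m₃ y w : Set (BondConfig (Site d))) := by simpa [lineEvents₄] using hKA 2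
  have hA3 : K 3 ∈ (openConnGe m₄ w x : Set (BondConfig (Site d))) := by simpa [lineEvents₄] using hKA 3
  obtain ⟨h0v, hb₁⟩ := (mem_openConnEq_one_iff (0 : Site d) v (K 0)).1 hA0
  have hb₁1 : s((0 : Site d), v) ∉ K 1 := fun h' =>
    Set.disjoint_left.1 (hdisj (show (0 : Fin 4) ≠ 1 by decide)) hb₁ h'
  have hb₁2 : s((0 : Site d), v) ∉ K 2 := fun h' =>
    Set.disjoint_left.1 (hdisj (show (0 : Fin 4) ≠ 2 by decide)) hb₁ h'
  have hb₁3 : s((0 : Site d), v) ∉ K 3 := fun h' =>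
    Set.disjoint_left.1 (hdisj (show (0 : Fin 4) ≠ 3 by decide)) hb₁ h'
  have hd12 : Disjoint (K 1) (K 2) := hdisj (show (1 : Fin 4) ≠ 2 by decide)
  have hd13 : Disjoint (K 1) (K 3) := hdisj (show (1 : Fin 4) ≠ 3 by decide)
  have hd23 : Disjoint (K 2) (K 3) := hdisj (show (2 : Fin 4) ≠ 3 by decide)
  -- the witness configurations on four levels, the exact one shrunk to its bond
  let ω' : Fin 4 → BondConfig (Site d) := ![{s((0 : Site d), v)}, K 1, K 2, K 3]
  have hω'0 : ω' 0 = {s((0 : Site d), v)} := rfl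
  have hω'1 : ω' 1 = K 1 := rfl
  have hω'2 : ω' 2 = K 2 := rfl
  have hω'3 : ω' 3 = K 3 := rfl
  have hω'lat : ∀ j, ω' j ⊆ (zdGraph d).edgeSet := by
    intro j
    fin_cases j
    · show ({s((0 : Site d), v)} : Set (Sym2 (Site d))) ⊆ _
      exact Set.singleton_subset_iff.2 (hω _ (hKω 0 hb₁))
    · exact (hKω 1).trans (hω _)
    · exact (hKω 2).trans (hω _)
    · exact (hKω 3).trans (hω _)
  have hmem : ω' ∈ genDisjConnN (sqLines (fun i : Fin 4 => i) 1 m₂ m₃ m₄ v y w x) := by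
    refine ⟨fun i => ω' i, fun i => ?_, fun i => ?_, ?_⟩
    · fin_cases i <;> simp [sqLines]
    · fin_cases i
      · simpa [sqLines, GDLine.event, hω'0] using
          openConnEq_subset_openConnGe 1 (0 : Site d) v
            ((mem_openConnEq_one_iff (0 : Site d) v ({s((0 : Site d), v)} : Set (Sym2 (Site d)))).2
              ⟨h0v, Set.mem_singleton _⟩)
      · simpa [sqLines, GDLine.event, hω'1] using hA1
      · simpa [sqLines, GDLine.event, hω'2] using hA2
      · simpa [sqLines, GDLine.event, hω'3] using hA3
    · intro i j hij
      fin_cases i <;> fin_cases j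
      · exact absurd rfl hij
      · simpa [hω'0, hω'1] using hb₁1
      · simpa [hω'0, hω'2] using hb₁2
      · simpa [hω'0, hω'3] using hb₁3
      · simpa [hω'0, hω'1] using hb₁1
      · exact absurd rfl hij
      · simpa [hω'1, hω'2] using hd12
      · simpa [hω'1, hω'3] using hd13
      · simpa [hω'0, hω'2] using hb₁2
      · simpa [hω'1, hω'2] using hd12.symm
      · exact absurd rfl hij
      · simpa [hω'2, hω'3] using hd23
      · simpa [hω'0, hω'3] using hb₁3
      · simpa [hω'1, hω'3] using hd13.symm
      · simpa [hω'2, hω'3] using hd23.symm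
      · exact absurd rfl hij
  obtain ⟨L, r₁, r₂, r₃, W, hW, hr₁, hr₁₂, hr₂₃, hr₃L, hv, hy, hw, hx, h0, h1, h2, h3⟩ :=
    exists_trail_of_mem_genDisjConnN_sqLines hω'lat hmem
  -- the first arc is the single bond `(0,v)`: `r₁ = 1`
  have hcard₁ : (wordArc W 0 r₁).card ≤ 1 := by
    have hsub : wordArc W 0 r₁ ⊆ {s((0 : Site d), v)} := by
      intro e he
      have := h0 (Finset.mem_coe.2 he)
      simpa [hω'0] using this
    simpa using Finset.card_le_card hsub
  rw [hW.card_wordArc (by omega)] at hcard₁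
  have hr₁' : r₁ = 1 := by omega
  subst hr₁'
  refine ⟨L, r₂, r₃, W, hW, hr₁₂, hr₂₃, hr₃L, hv, hy, hw, hx, ?_, ?_, ?_, ?_⟩
  · refine h0.trans ?_
    rw [hω'0]
    exact Set.singleton_subset_iff.2 (hKω 0 hb₁)
  · exact h1.trans (by rw [hω'1]; exact hKω 1)
  · exact h2.trans (by rw [hω'2]; exact hKω 2)
  · exact h3.trans (by rw [hω'3]; exact hKω 3)

/-! ## B. Extraction: an open labelled trail with its pinned first bond lies in one of the (5.41) boxes -/

section Extraction

variable {k : ℕ} (c : Fin 4 → Fin k)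

/-- **Extraction with a pinned first bond** (the four cases of (5.41) at `(m₁,m₂,m₃) := (1+m₂, m₃, m₄)`, junctions
`(y,w)`, the position of `v` determined): an open labelled trail lies in the labelled box of an EXPLICIT index
(`L < M`), of a ONE-TAIL index (`r₃ < M − m₄`), of a TWO-TAIL index (`r₂ < M − (m₃+m₄) ≤ r₃`... read with the cut
on the third line: `M − m₄ ≤ r₃`) or of a THREE-TAIL index (`r₂ ≥ M − (m₃+m₄)`; the bond stays in `u₁` because
`m₃ + m₄ + 1 ≤ M`) — the landed `sqPiecesE W 1 r₂ r₃`, `sqPiecesO u 1 r₂ r₃ x`, `sqPiecesT2 u₁ 1 r₂ u₄ x w`,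
`sqPiecesT3 u₁ 1 u₃ u₄ x y w`.
[cite: FitznerVanDerHofstad2016NoBLE, §5.3.1 (5.38) p. 1097, §5.3.2 (5.41)–(5.42) p. 1098]
[cite: FitznerVanDerHofstad2017, §4.2, display after (4.18) (arXiv:1506.07977v2 p. 36 = EJP p. 33)] -/
theorem mem_sqBoxes_of_trail_eqOne₁ (m₂ m₃ m₄ M : ℕ) (hM : m₃ + m₄ + 1 ≤ M) {ω : Fin k → BondConfig (Site d)}
    {L r₂ r₃ : ℕ} {v y w x : Site d} {W : Fin L → Fin d × Bool} (hW : IsTrail W) (hr₂ : 1 + m₂ ≤ r₂)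
    (hr₂₃ : r₂ + m₃ ≤ r₃) (hr₃L : r₃ + m₄ ≤ L)
    (hv : wordPos W 1 = v) (hy : wordPos W r₂ = y) (hw : wordPos W r₃ = w) (hx : wordPos W L = x)
    (h0 : (↑(wordArc W 0 1) : Set (Sym2 (Site d))) ⊆ ω (c 0))
    (h1 : (↑(wordArc W 1 r₂) : Set (Sym2 (Site d))) ⊆ ω (c 1))
    (h2 : (↑(wordArc W r₂ r₃) : Set (Sym2 (Site d))) ⊆ ω (c 2))
    (h3 : (↑(wordArc W r₃ L) : Set (Sym2 (Site d))) ⊆ ω (c 3)) :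
    (∃ t ∈ idxExplicitT (1 + m₂) m₃ m₄ M x y w,
        wordPos t.2.1 1 = v ∧ ω ∈ boxOf₄ (sqPiecesE t.2.1 1 t.2.2.1 t.2.2.2) sqLabE c) ∨
      (∃ t ∈ idxOneTailT (d := d) (1 + m₂) m₃ m₄ M y w,
          wordPos t.1 1 = v ∧ ω ∈ boxOf₄ (sqPiecesO t.1 1 t.2.1 t.2.2 x) sqLabO c) ∨
        (∃ t ∈ idxTwoTailT (d := d) (1 + m₂) m₃ m₄ M y,
            wordPos t.1.1 1 = v ∧ ω ∈ boxOf₄ (sqPiecesT2 t.1.1 1 t.1.2 t.2 x w) sqLabT2 c) ∨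
          ∃ t ∈ idxThreeTailT (d := d) m₃ m₄ M,
            wordPos t.1 1 = v ∧ ω ∈ boxOf₄ (sqPiecesT3 t.1 1 t.2.1 t.2.2 x y w) sqLabT3 c := by
  classical
  by_cases hLM : L < M
  · refine Or.inl ⟨⟨L, (W, (r₂, r₃))⟩, ?_, hv, ?_⟩
    · simp only [idxExplicitT, baseExplicitT, triPairsE, Finset.mem_filter, Finset.mem_sigma, Finset.mem_product,
        mem_trailWordsTo, Finset.mem_Ico, Finset.mem_Icc]
      exact ⟨⟨⟨by omega, hLM⟩, ⟨hW, hx⟩, ⟨⟨by omega, by omega⟩, ⟨by omega, by omega⟩⟩, hr₂₃⟩, hy, hw⟩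
    · show ω ∈ boxOf₄ (sqPiecesE W 1 r₂ r₃) sqLabE c
      exact mem_sqBoxE_of_trail c hW (by omega) (by omega) (by omega) h0 h1 h2 h3
  · replace hLM : M ≤ L := not_lt.1 hLM
    by_cases hr₃M : r₃ < M - m₄
    · refine Or.inr (Or.inl ⟨(wordTake W M hLM, (r₂, r₃)), ?_, ?_, ?_⟩)
      · simp only [idxOneTailT, baseOneTailT, triPairsO, Finset.mem_filter, Finset.mem_product, mem_trailWords,
          Finset.mem_Ico]
        refine ⟨⟨hW.wordTake hLM, ⟨⟨by omega, by omega⟩, ⟨by omega, hr₃M⟩⟩, hr₂₃⟩, ?_, ?_⟩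
        · rw [wordPos_wordTake W hLM (by omega), hy]
        · rw [wordPos_wordTake W hLM (by omega), hw]
      · show wordPos (wordTake W M hLM) 1 = v
        rw [wordPos_wordTake W hLM (by omega), hv]
      · show ω ∈ boxOf₄ (sqPiecesO (wordTake W M hLM) 1 r₂ r₃ x) sqLabO c
        exact mem_sqBoxO_of_trail c hW hLM (by omega) (by omega) (by omega) hx h0 h1 h2 h3
    · replace hr₃M : M - m₄ ≤ r₃ := not_lt.1 hr₃M
      by_cases hr₂M : r₂ < M - (m₃ + m₄)
      · have hML : M - m₄ ≤ L := by omega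
        refine Or.inr (Or.inr (Or.inl ⟨((wordTake W (M - m₄) hML, r₂), wordSeg W r₃ m₄ hr₃L), ?_, ?_, ?_⟩))
        · simp only [idxTwoTailT, baseTwoTailT, Finset.mem_filter, Finset.mem_product, mem_trailWords,
            Finset.mem_Ico]
          refine ⟨⟨⟨hW.wordTake hML, by omega, hr₂M⟩, hW.wordSeg hr₃L⟩, ?_⟩
          rw [wordPos_wordTake W hML (by omega), hy]
        · show wordPos (wordTake W (M - m₄) hML) 1 = v
          rw [wordPos_wordTake W hML (by omega), hv]
        · show ω ∈ boxOf₄ (sqPiecesT2 (wordTake W (M - m₄) hML) 1 r₂ (wordSeg W r₃ m₄ hr₃L) x w) sqLabT2 c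
          exact mem_sqBoxT2_of_trail c hW (by omega) (by omega) hr₃M hr₃L hML hw hx h0 h1 h2 h3
      · replace hr₂M : M - (m₃ + m₄) ≤ r₂ := not_lt.1 hr₂M
        have hML : M - (m₃ + m₄) ≤ L := by omega
        have hr₂L : r₂ + m₃ ≤ L := by omega
        refine Or.inr (Or.inr (Or.inr
          ⟨(wordTake W (M - (m₃ + m₄)) hML, (wordSeg W r₂ m₃ hr₂L, wordSeg W r₃ m₄ hr₃L)), ?_, ?_, ?_⟩))
        · simp only [idxThreeTailT, Finset.mem_product, mem_trailWords]
          exact ⟨hW.wordTake hML, hW.wordSeg hr₂L, hW.wordSeg hr₃L⟩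
        · show wordPos (wordTake W (M - (m₃ + m₄)) hML) 1 = v
          rw [wordPos_wordTake W hML (by omega), hv]
        · show ω ∈ boxOf₄ (sqPiecesT3 (wordTake W (M - (m₃ + m₄)) hML) 1 (wordSeg W r₂ m₃ hr₂L)
            (wordSeg W r₃ m₄ hr₃L) x y w) sqLabT3 c
          exact mem_sqBoxT3_of_trail c hW (by omega) hr₂M hr₂₃ hr₃L hML hr₂L hy hw hx h0 h1 h2 h3

end Extraction

/-! ## C. The pointwise bound of a member -/

section Pointwise

variable {k : ℕ}

/-- **(4.17) for the square with an exact first bond, member `c`, pointwise in `v` at the junctions `(y,w)`, by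
extraction**: `ℙ_p^{⊗k}({0 –1̲– v}_{c₀} ⊛ {v ←m₂→ y}_{c₁} ⊛ {y ←m₃→ w}_{c₂} ⊛ {w ←m₄→ x}_{c₃})` is at most the sum
of the (5.41) values (junctions `(y,w)`, line indices `(1+m₂, m₃, m₄)`) over the indices whose determined first
position is `v`: configurations off the lattice are null; on the lattice the coded trail lies in a box
(`mem_sqBoxes_of_trail_eqOne₁`) whose measure is the value (`piReal_sqBoxE_le`, `piReal_sqBoxO_le`,
`piReal_sqBoxT2_le`, `piReal_sqBoxT3_le`).
[cite: FitznerVanDerHofstad2016NoBLE, §5.3.2 (5.41)–(5.42) PTRF p. 1098]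
[cite: FitznerVanDerHofstad2017, §4.2 (4.17) and the display after (4.18) (arXiv:1506.07977v2 p. 36 = EJP p. 33)] -/
theorem piReal_genDisjOcc_lineEvents₄_eqOne₁_le (c : Fin 4 → Fin k) (p : unitInterval) (m₂ m₃ m₄ M : ℕ)
    (hM : m₃ + m₄ + 1 ≤ M) (x y w v : Site d) :
    (Measure.pi (fun _ : Fin k => bondPercolation (zdGraph d) p)).real
        (genDisjOcc (lineEvents₄ (eq 1) (ge m₂) (ge m₃) (ge m₄) v y w x) c) ≤
      (∑ t ∈ (idxExplicitT (1 + m₂) m₃ m₄ M x y w).filter (fun t => wordPos t.2.1 1 = v), (p : ℝ) ^ t.1) +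
        (∑ t ∈ (idxOneTailT (d := d) (1 + m₂) m₃ m₄ M y w).filter (fun t => wordPos t.1 1 = v),
            (p : ℝ) ^ M * tau d p (wordPos t.1 M) x) +
          (∑ t ∈ (idxTwoTailT (d := d) (1 + m₂) m₃ m₄ M y).filter (fun t => wordPos t.1.1 1 = v),
              (p : ℝ) ^ (M - m₄) * (p : ℝ) ^ m₄ *
                (tau d p (wordPos t.1.1 (M - m₄)) w * tau d p (w + wordPos t.2 m₄) x)) +
            ∑ t ∈ (idxThreeTailT (d := d) m₃ m₄ M).filter (fun t => wordPos t.1 1 = v),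
              (p : ℝ) ^ (M - (m₃ + m₄)) * (p : ℝ) ^ m₃ * (p : ℝ) ^ m₄ *
                (tau d p (wordPos t.1 (M - (m₃ + m₄))) y * tau d p (y + wordPos t.2.1 m₃) w *
                  tau d p (w + wordPos t.2.2 m₄) x) := by
  classical
  set μ := bondPercolation (zdGraph d) p with hμ
  set ν : Measure (Fin k → BondConfig (Site d)) := Measure.pi (fun _ : Fin k => μ) with hν
  set T : Set (Fin k → BondConfig (Site d)) :=
    genDisjOcc (lineEvents₄ (eq 1) (ge m₂) (ge m₃) (ge m₄) v y w x) c with hT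
  set IE := (idxExplicitT (1 + m₂) m₃ m₄ M x y w).filter (fun t => wordPos t.2.1 1 = v) with hIE
  set IO := (idxOneTailT (d := d) (1 + m₂) m₃ m₄ M y w).filter (fun t => wordPos t.1 1 = v) with hIO
  set IT := (idxTwoTailT (d := d) (1 + m₂) m₃ m₄ M y).filter (fun t => wordPos t.1.1 1 = v) with hIT
  set IH := (idxThreeTailT (d := d) m₃ m₄ M).filter (fun t => wordPos t.1 1 = v) with hIH
  set UE : Set (Fin k → BondConfig (Site d)) :=
    ⋃ t ∈ IE, boxOf₄ (sqPiecesE t.2.1 1 t.2.2.1 t.2.2.2) sqLabE c with hUE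
  set UO : Set (Fin k → BondConfig (Site d)) := ⋃ t ∈ IO, boxOf₄ (sqPiecesO t.1 1 t.2.1 t.2.2 x) sqLabO c with hUO
  set UT : Set (Fin k → BondConfig (Site d)) :=
    ⋃ t ∈ IT, boxOf₄ (sqPiecesT2 t.1.1 1 t.1.2 t.2 x w) sqLabT2 c with hUT
  set UH : Set (Fin k → BondConfig (Site d)) :=
    ⋃ t ∈ IH, boxOf₄ (sqPiecesT3 t.1 1 t.2.1 t.2.2 x y w) sqLabT3 c with hUH
  set bad : Set (Fin k → BondConfig (Site d)) :=
    ⋃ j : Fin k, Function.eval j ⁻¹' {ω | ¬ ω ⊆ (zdGraph d).edgeSet} with hbad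
  have h0 : μ {ω | ¬ ω ⊆ (zdGraph d).edgeSet} = 0 := by
    have := ProbabilityTheory.setBernoulli_ae_subset (u := (zdGraph d).edgeSet) (p := p)
    rw [Filter.Eventually, mem_ae_iff, Set.compl_setOf] at this
    exact this
  have hbad0 : ν.real bad = 0 := by
    rw [measureReal_def, measure_iUnion_null fun j => ?_, ENNReal.toReal_zero]
    exact Measure.pi_eval_preimage_null (fun _ : Fin k => μ) h0
  -- the covering
  have hcov : T ⊆ bad ∪ (UE ∪ UO ∪ UT ∪ UH) := by
    intro ω hω
    by_cases hb : ∀ j, ω j ⊆ (zdGraph d).edgeSet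
    · right
      obtain ⟨L, r₂, r₃, W, hW, hr₂, hr₂₃, hr₃L, hv, hy, hw, hx, hW0, hW1, hW2, hW3⟩ :=
        exists_trail_of_mem_genDisjOcc_lineEvents₄_eqOne₁ hb hω
      rcases mem_sqBoxes_of_trail_eqOne₁ c m₂ m₃ m₄ M hM hW hr₂ hr₂₃ hr₃L hv hy hw hx hW0 hW1 hW2 hW3 with
        ⟨t, ht, htv, hωE⟩ | ⟨t, ht, htv, hωO⟩ | ⟨t, ht, htv, hωT⟩ | ⟨t, ht, htv, hωH⟩
      · exact Or.inl (Or.inl (Or.inl (Set.mem_iUnion₂.2 ⟨t, Finset.mem_filter.2 ⟨ht, htv⟩, hωE⟩)))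
      · exact Or.inl (Or.inl (Or.inr (Set.mem_iUnion₂.2 ⟨t, Finset.mem_filter.2 ⟨ht, htv⟩, hωO⟩)))
      · exact Or.inl (Or.inr (Set.mem_iUnion₂.2 ⟨t, Finset.mem_filter.2 ⟨ht, htv⟩, hωT⟩))
      · exact Or.inr (Set.mem_iUnion₂.2 ⟨t, Finset.mem_filter.2 ⟨ht, htv⟩, hωH⟩)
    · left
      obtain ⟨j, hj⟩ := not_forall.1 hb
      exact Set.mem_iUnion.2 ⟨j, hj⟩
  -- the measure of each box
  have hE : ν.real UE ≤ ∑ t ∈ IE, (p : ℝ) ^ t.1 := by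
    refine (measureReal_biUnion_finset_le _ _).trans (Finset.sum_le_sum fun t ht => ?_)
    have hi := (Finset.mem_filter.1 ht).1
    simp only [idxExplicitT, baseExplicitT, triPairsE, Finset.mem_filter, Finset.mem_sigma, Finset.mem_product,
      mem_trailWordsTo, Finset.mem_Ico, Finset.mem_Icc] at hi
    exact piReal_sqBoxE_le c p hi.1.2.1.1 (by omega) (by omega) (by omega)
  have hO : ν.real UO ≤ ∑ t ∈ IO, (p : ℝ) ^ M * tau d p (wordPos t.1 M) x := by
    refine (measureReal_biUnion_finset_le _ _).trans (Finset.sum_le_sum fun t ht => ?_)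
    have hi := (Finset.mem_filter.1 ht).1
    simp only [idxOneTailT, baseOneTailT, triPairsO, Finset.mem_filter, Finset.mem_product, mem_trailWords,
      Finset.mem_Ico] at hi
    exact piReal_sqBoxO_le c p hi.1.1 (by omega) (by omega) (by omega) x
  have hT2 : ν.real UT ≤ ∑ t ∈ IT, (p : ℝ) ^ (M - m₄) * (p : ℝ) ^ m₄ *
      (tau d p (wordPos t.1.1 (M - m₄)) w * tau d p (w + wordPos t.2 m₄) x) := by
    refine (measureReal_biUnion_finset_le _ _).trans (Finset.sum_le_sum fun t ht => ?_)
    have hi := (Finset.mem_filter.1 ht).1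
    simp only [idxTwoTailT, baseTwoTailT, Finset.mem_filter, Finset.mem_product, mem_trailWords,
      Finset.mem_Ico] at hi
    exact piReal_sqBoxT2_le c p hi.1.1.1 hi.1.2 (by omega) (by omega) x w
  have hT3 : ν.real UH ≤ ∑ t ∈ IH, (p : ℝ) ^ (M - (m₃ + m₄)) * (p : ℝ) ^ m₃ * (p : ℝ) ^ m₄ *
      (tau d p (wordPos t.1 (M - (m₃ + m₄))) y * tau d p (y + wordPos t.2.1 m₃) w *
        tau d p (w + wordPos t.2.2 m₄) x) := by
    refine (measureReal_biUnion_finset_le _ _).trans (Finset.sum_le_sum fun t ht => ?_)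
    have hi := (Finset.mem_filter.1 ht).1
    simp only [idxThreeTailT, Finset.mem_product, mem_trailWords] at hi
    exact piReal_sqBoxT3_le c p hi.1 hi.2.1 hi.2.2 (by omega) x y w
  calc ν.real T ≤ ν.real (bad ∪ (UE ∪ UO ∪ UT ∪ UH)) := measureReal_mono hcov
    _ ≤ ν.real bad + ν.real (UE ∪ UO ∪ UT ∪ UH) := measureReal_union_le _ _
    _ ≤ 0 + (ν.real UE + ν.real UO + ν.real UT + ν.real UH) := by
        refine add_le_add hbad0.le ((measureReal_union_le _ _).trans ?_)
        refine add_le_add ((measureReal_union_le _ _).trans ?_) le_rfl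
        exact add_le_add (measureReal_union_le _ _) le_rfl
    _ ≤ _ := by rw [zero_add]; exact add_le_add (add_le_add (add_le_add hE hO) hT2) hT3

/-- `ℙ_p^{⊗4}` of the instance's square letters is the product Bernoulli measure, in `ℝ≥0∞` (first line exact).
[cite: FitznerVanDerHofstad2017, §4.2 (4.17) and the sentence after it (arXiv:1506.07977v2 p. 36)] -/
theorem piPerc_genDisjOcc_lineEvents₄_eqOne₁_eq_ofReal (p : unitInterval) (c : Fin 4 → Fin 4) (j₂ j₃ j₄ : LenIdx)
    (v y w x : Site d) :
    piPerc d p 4 (genDisjOcc (lineEvents₄ (eq 1) j₂ j₃ j₄ v y w x) c) =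
      ENNReal.ofReal ((Measure.pi (fun _ : Fin 4 => bondPercolation (zdGraph d) p)).real
        (genDisjOcc (lineEvents₄ (eq 1) j₂ j₃ j₄ v y w x) c)) := by
  rw [piPerc, ofReal_measureReal (measure_ne_top _ _)]

end Pointwise

/-! ## D. The letter `𝓢_{1̲,m₂,m₃,m₄}` of the instance: maximum over the assignments, (5.41) slots, `∑'` -/

section Letter

variable (p : unitInterval)

/-- **`𝓢_{1̲,m₂,m₃,m₄}(v,y,w,x)` pointwise by extraction** (every member of the maximum obeys
`piReal_genDisjOcc_lineEvents₄_eqOne₁_le`, whose right-hand side does not depend on the assignment).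
[cite: FitznerVanDerHofstad2017, §4.2 (4.17) (arXiv:1506.07977v2 p. 36 = EJP p. 33)]
[cite: FitznerVanDerHofstad2016NoBLE, §5.3.2 (5.41)–(5.42) PTRF p. 1098] -/
theorem perc_S_eqOne_ge_ge_ge_toReal_le_sum_filter (m₂ m₃ m₄ M : ℕ) (hM : m₃ + m₄ + 1 ≤ M) (x y w v : Site d) :
    ((Letters.perc d p).S (eq 1) (ge m₂) (ge m₃) (ge m₄) v y w x).toReal ≤
      (∑ t ∈ (idxExplicitT (1 + m₂) m₃ m₄ M x y w).filter (fun t => wordPos t.2.1 1 = v), (p : ℝ) ^ t.1) +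
        (∑ t ∈ (idxOneTailT (d := d) (1 + m₂) m₃ m₄ M y w).filter (fun t => wordPos t.1 1 = v),
            (p : ℝ) ^ M * tau d p (wordPos t.1 M) x) +
          (∑ t ∈ (idxTwoTailT (d := d) (1 + m₂) m₃ m₄ M y).filter (fun t => wordPos t.1.1 1 = v),
              (p : ℝ) ^ (M - m₄) * (p : ℝ) ^ m₄ *
                (tau d p (wordPos t.1.1 (M - m₄)) w * tau d p (w + wordPos t.2 m₄) x)) +
            ∑ t ∈ (idxThreeTailT (d := d) m₃ m₄ M).filter (fun t => wordPos t.1 1 = v),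
              (p : ℝ) ^ (M - (m₃ + m₄)) * (p : ℝ) ^ m₃ * (p : ℝ) ^ m₄ *
                (tau d p (wordPos t.1 (M - (m₃ + m₄))) y * tau d p (y + wordPos t.2.1 m₃) w *
                  tau d p (w + wordPos t.2.2 m₄) x) := by
  classical
  have hp0 : 0 ≤ (p : ℝ) := p.2.1
  set B := (∑ t ∈ (idxExplicitT (1 + m₂) m₃ m₄ M x y w).filter (fun t => wordPos t.2.1 1 = v), (p : ℝ) ^ t.1) +
        (∑ t ∈ (idxOneTailT (d := d) (1 + m₂) m₃ m₄ M y w).filter (fun t => wordPos t.1 1 = v),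
            (p : ℝ) ^ M * tau d p (wordPos t.1 M) x) +
          (∑ t ∈ (idxTwoTailT (d := d) (1 + m₂) m₃ m₄ M y).filter (fun t => wordPos t.1.1 1 = v),
              (p : ℝ) ^ (M - m₄) * (p : ℝ) ^ m₄ *
                (tau d p (wordPos t.1.1 (M - m₄)) w * tau d p (w + wordPos t.2 m₄) x)) +
            ∑ t ∈ (idxThreeTailT (d := d) m₃ m₄ M).filter (fun t => wordPos t.1 1 = v),
              (p : ℝ) ^ (M - (m₃ + m₄)) * (p : ℝ) ^ m₃ * (p : ℝ) ^ m₄ *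
                (tau d p (wordPos t.1 (M - (m₃ + m₄))) y * tau d p (y + wordPos t.2.1 m₃) w *
                  tau d p (w + wordPos t.2.2 m₄) x) with hB
  have hB0 : 0 ≤ B :=
    add_nonneg (add_nonneg (add_nonneg (Finset.sum_nonneg fun _ _ => pow_nonneg hp0 _)
      (Finset.sum_nonneg fun _ _ => mul_nonneg (pow_nonneg hp0 _) (tau_nonneg _ _ _)))
      (Finset.sum_nonneg fun _ _ => mul_nonneg (mul_nonneg (pow_nonneg hp0 _) (pow_nonneg hp0 _))
        (mul_nonneg (tau_nonneg _ _ _) (tau_nonneg _ _ _))))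
      (Finset.sum_nonneg fun _ _ => mul_nonneg (mul_nonneg (mul_nonneg (pow_nonneg hp0 _) (pow_nonneg hp0 _))
        (pow_nonneg hp0 _)) (mul_nonneg (mul_nonneg (tau_nonneg _ _ _) (tau_nonneg _ _ _)) (tau_nonneg _ _ _)))
  have hle : (Letters.perc d p).S (eq 1) (ge m₂) (ge m₃) (ge m₄) v y w x ≤ ENNReal.ofReal B := by
    rw [perc_S, repLetter]
    refine Finset.sup_le fun c _ => ?_
    rw [piPerc_genDisjOcc_lineEvents₄_eqOne₁_eq_ofReal]
    exact ENNReal.ofReal_le_ofReal (piReal_genDisjOcc_lineEvents₄_eqOne₁_le c p m₂ m₃ m₄ M hM x y w v)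
  have := ENNReal.toReal_mono ENNReal.ofReal_ne_top hle
  rwa [ENNReal.toReal_ofReal hB0] at this

/-- **[NoBLE17] (5.41) shape for `Σ_{v∈S₁} 𝓢_{1̲,m₂,m₃,m₄}(v,y,w,x)`** (line indices `(1+m₂, m₃, m₄)`, junctions
`(y,w)`): the pointwise hypothesis of `sum_sum_le_extractionT_of_pointwise` — the sum over the determined first
position `v` is fiberwise, so the multiplicity stays that of the triangle.
[cite: FitznerVanDerHofstad2016NoBLE, §5.3.2 (5.41) PTRF p. 1098]
[cite: FitznerVanDerHofstad2017, §4.2 (4.17), display after (4.18) (arXiv:1506.07977v2 p. 36 = EJP p. 33)] -/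
theorem sum_perc_S_eqOne_ge_ge_ge_toReal_le_extraction (m₂ m₃ m₄ M : ℕ) (hM : m₃ + m₄ + 1 ≤ M) (x y w : Site d)
    (S₁ : Finset (Site d)) :
    ∑ v ∈ S₁, ((Letters.perc d p).S (eq 1) (ge m₂) (ge m₃) (ge m₄) v y w x).toReal ≤
      (∑ t ∈ idxExplicitT (1 + m₂) m₃ m₄ M x y w, (p : ℝ) ^ t.1) +
        (∑ t ∈ idxOneTailT (d := d) (1 + m₂) m₃ m₄ M y w, (p : ℝ) ^ M * tau d p (wordPos t.1 M) x) +
          (∑ t ∈ idxTwoTailT (d := d) (1 + m₂) m₃ m₄ M y,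
              (p : ℝ) ^ (M - m₄) * (p : ℝ) ^ m₄ *
                (tau d p (wordPos t.1.1 (M - m₄)) w * tau d p (w + wordPos t.2 m₄) x)) +
            ∑ t ∈ idxThreeTailT (d := d) m₃ m₄ M,
              (p : ℝ) ^ (M - (m₃ + m₄)) * (p : ℝ) ^ m₃ * (p : ℝ) ^ m₄ *
                (tau d p (wordPos t.1 (M - (m₃ + m₄))) y * tau d p (y + wordPos t.2.1 m₃) w *
                  tau d p (w + wordPos t.2.2 m₄) x) := by
  classical
  have hp0 : 0 ≤ (p : ℝ) := p.2.1
  refine (Finset.sum_le_sum fun v _ =>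
    perc_S_eqOne_ge_ge_ge_toReal_le_sum_filter p m₂ m₃ m₄ M hM x y w v).trans ?_
  rw [Finset.sum_add_distrib, Finset.sum_add_distrib, Finset.sum_add_distrib]
  refine add_le_add (add_le_add (add_le_add ?_ ?_) ?_) ?_
  · exact Finset.sum_fiberwise_le_sum_of_sum_fiber_nonneg fun _ _ =>
      Finset.sum_nonneg fun _ _ => pow_nonneg hp0 _
  · exact Finset.sum_fiberwise_le_sum_of_sum_fiber_nonneg fun _ _ =>
      Finset.sum_nonneg fun _ _ => mul_nonneg (pow_nonneg hp0 _) (tau_nonneg _ _ _)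
  · exact Finset.sum_fiberwise_le_sum_of_sum_fiber_nonneg fun _ _ =>
      Finset.sum_nonneg fun _ _ => mul_nonneg (mul_nonneg (pow_nonneg hp0 _) (pow_nonneg hp0 _))
        (mul_nonneg (tau_nonneg _ _ _) (tau_nonneg _ _ _))
  · exact Finset.sum_fiberwise_le_sum_of_sum_fiber_nonneg fun _ _ =>
      Finset.sum_nonneg fun _ _ => mul_nonneg (mul_nonneg (mul_nonneg (pow_nonneg hp0 _) (pow_nonneg hp0 _))
        (pow_nonneg hp0 _)) (mul_nonneg (mul_nonneg (tau_nonneg _ _ _) (tau_nonneg _ _ _)) (tau_nonneg _ _ _))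

/-- **EXL-XSLOT (square, first bond exact) at remainder slots, all finite `S₁, S₂, S₃`** (`d ≥ 2`, `p < p_c`,
`m₃ + m₄ + 1 ≤ M`, `x ∈ X`; `R₁` valid for `[M]`, `R₂` for `[M−m₄, m₄]`, `R₃` for `[M−(m₃+m₄), m₃, m₄]` on `X`):
`Σ_{y∈S₂} Σ_{w∈S₃} Σ_{v∈S₁} 𝓢_{1̲,m₂,m₃,m₄}(v,y,w,x) ≤ Σ_{L=1+m₂+m₃+m₄}^{M−1} C(L+1−m₂−m₃−m₄,2) a_L(x) p^L`
` + C(M−m₂−m₃−m₄,2) p^M Γ̄₂ R₁ + (M−1−m₂−m₃−m₄) p^M Γ̄₂² R₂ + p^M Γ̄₂³ R₃` — the repulsive TRIANGLE bound (5.41) at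
`(1+m₂, m₃, m₄)`: the exact bond costs one unit of length and no multiplicity.
[cite: FitznerVanDerHofstad2016NoBLE, §5.3.2 (5.41) p. 1098, first display p. 1097]
[cite: FitznerVanDerHofstad2017, §4.2 (4.17), (4.18) and the display after it (arXiv:1506.07977v2 p. 36)] -/
theorem sum3_perc_S_eqOne_ge_ge_ge_toReal_le_slots (hd : 2 ≤ d) (hp : p < criticalProbI d) {m₂ m₃ m₄ M : ℕ}
    (hM : m₃ + m₄ + 1 ≤ M) {x : Site d} {X : Set (Site d)} (hx : x ∈ X) {R₁ R₂ R₃ : ℝ}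
    (hR₁ : IsRemKernelConst d [M] X R₁) (hR₂ : IsRemKernelConst d [M - m₄, m₄] X R₂)
    (hR₃ : IsRemKernelConst d [M - (m₃ + m₄), m₃, m₄] X R₃) (S₁ S₂ S₃ : Finset (Site d)) :
    ∑ y ∈ S₂, ∑ w ∈ S₃, ∑ v ∈ S₁, ((Letters.perc d p).S (eq 1) (ge m₂) (ge m₃) (ge m₄) v y w x).toReal ≤
      (∑ L ∈ Finset.Ico ((1 + m₂) + m₃ + m₄) M,
          (((L + 2 - ((1 + m₂) + m₃ + m₄)).choose 2 : ℕ) : ℝ) * ((trailWordsTo d L x).card : ℝ) * (p : ℝ) ^ L) +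
        (((M + 1 - ((1 + m₂) + m₃ + m₄)).choose 2 : ℕ) : ℝ) * ((p : ℝ) ^ M * (nobleSup2 d p * R₁)) +
          ((M - ((1 + m₂) + m₃ + m₄) : ℕ) : ℝ) * ((p : ℝ) ^ M * (nobleSup2 d p ^ 2 * R₂)) +
            (p : ℝ) ^ M * (nobleSup2 d p ^ 3 * R₃) :=
  sum_sum_le_repTriangle_slots
    (D := fun y w => ∑ v ∈ S₁, ((Letters.perc d p).S (eq 1) (ge m₂) (ge m₃) (ge m₄) v y w x).toReal)
    (fun S₂ S₃ => le_extractionT_choose_of_le p (1 + m₂) m₃ m₄ M x S₂ S₃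
      (sum_sum_le_extractionT_of_pointwise p (1 + m₂) m₃ m₄ M x S₂ S₃
        fun y _ w _ => sum_perc_S_eqOne_ge_ge_ge_toReal_le_extraction p m₂ m₃ m₄ M hM x y w S₁))
    hd hp (by omega) hx hR₁ hR₂ hR₃ S₂ S₃

/-- **EXL-XSLOT (square, first bond exact), `∑'`/`ofReal` shape with the out-point on the unit vectors and the
trail-word counts read through a majorant `N`** (`d ≥ 2`, `p < p_c`, `m₃ + m₄ + 1 ≤ M`, `x ∈ X`,
`∀ L, #trailWordsTo d L x ≤ N L`, `R₁, R₂, R₃` remainder-kernel constants on `X`):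
`Σ'_y Σ'_w Σ_κ 𝓢_{1̲,m₂,m₃,m₄}(e_κ,y,w,x) ≤ ofReal (triangleSlotR p Γ̄₂ (1+m₂) m₃ m₄ M N R₁ R₂ R₃)`
`= ofReal (Σ_L C(L+2−m,2) N_L p^L + C(M+1−m,2) p^M Γ̄₂ R₁ + (M−m) p^M Γ̄₂² R₂ + p^M Γ̄₂³ R₃)`, `m = 1 + m₂ + m₃ + m₄` — every
finite partial sum is below the right-hand side (the `2d` unit vectors are distinct sites; `triangleSlotR_mono_count`).
[cite: FitznerVanDerHofstad2016NoBLE, §5.3.2 (5.41) (PTRF 169 (2017) p. 1098)]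
[cite: FitznerVanDerHofstad2017, §4.2 (4.17), (4.18) and the display after it (arXiv:1506.07977v2 p. 36); (5.1) p. 49] -/
theorem tsum_tsum_sum_perc_S_eqOne_ge_ge_ge_stepVec_le_ofReal (hd : 2 ≤ d) (hp : p < criticalProbI d)
    {m₂ m₃ m₄ M : ℕ} (hM : m₃ + m₄ + 1 ≤ M) {x : Site d} {X : Set (Site d)} (hx : x ∈ X) {N : ℕ → ℕ}
    (hN : ∀ L, (trailWordsTo d L x).card ≤ N L) {R₁ R₂ R₃ : ℝ} (hR₁ : IsRemKernelConst d [M] X R₁)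
    (hR₂ : IsRemKernelConst d [M - m₄, m₄] X R₂) (hR₃ : IsRemKernelConst d [M - (m₃ + m₄), m₃, m₄] X R₃) :
    ∑' y, ∑' w, ∑ κ : Fin d × Bool, (Letters.perc d p).S (eq 1) (ge m₂) (ge m₃) (ge m₄) (stepVec κ) y w x ≤
      ENNReal.ofReal (triangleSlotR p (nobleSup2 d p) (1 + m₂) m₃ m₄ M N R₁ R₂ R₃) := by
  classical
  have hp0 : 0 ≤ (p : ℝ) := p.2.1
  rw [← ENNReal.tsum_prod, ENNReal.tsum_eq_iSup_sum]
  refine iSup_le fun Q => ?_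
  set f : Site d → Site d → Site d → ℝ≥0∞ :=
    fun v y w => (Letters.perc d p).S (eq 1) (ge m₂) (ge m₃) (ge m₄) v y w x with hf
  set V : Finset (Site d) := Finset.univ.image (stepVec : Fin d × Bool → Site d) with hV
  have hfin : ∀ v y w, f v y w = ENNReal.ofReal ((f v y w).toReal) := fun v y w =>
    (ENNReal.ofReal_toReal ((perc_S_le_one p _ _ _ _ _ _ _ _).trans_lt ENNReal.one_lt_top).ne).symm
  have hκ : ∀ y w, ∑ κ : Fin d × Bool, f (stepVec κ) y w = ∑ v ∈ V, f v y w := fun y w => by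
    rw [hV, Finset.sum_image fun a _ b _ h => stepVec_injective' h]
  calc ∑ q ∈ Q, ∑ κ : Fin d × Bool, f (stepVec κ) q.1 q.2
      ≤ ∑ q ∈ Q.image Prod.fst ×ˢ Q.image Prod.snd, ∑ κ : Fin d × Bool, f (stepVec κ) q.1 q.2 :=
        Finset.sum_le_sum_of_subset Finset.subset_product
    _ = ∑ y ∈ Q.image Prod.fst, ∑ w ∈ Q.image Prod.snd, ∑ v ∈ V, f v y w := by
        rw [Finset.sum_product]
        exact Finset.sum_congr rfl fun y _ => Finset.sum_congr rfl fun w _ => hκ y w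
    _ = ∑ y ∈ Q.image Prod.fst, ∑ w ∈ Q.image Prod.snd, ∑ v ∈ V, ENNReal.ofReal ((f v y w).toReal) :=
        Finset.sum_congr rfl fun y _ => Finset.sum_congr rfl fun w _ => Finset.sum_congr rfl fun v _ => hfin v y w
    _ = ENNReal.ofReal (∑ y ∈ Q.image Prod.fst, ∑ w ∈ Q.image Prod.snd, ∑ v ∈ V, (f v y w).toReal) := by
        rw [ENNReal.ofReal_sum_of_nonneg fun y _ =>
          Finset.sum_nonneg fun w _ => Finset.sum_nonneg fun v _ => ENNReal.toReal_nonneg]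
        refine Finset.sum_congr rfl fun y _ => ?_
        rw [ENNReal.ofReal_sum_of_nonneg fun w _ => Finset.sum_nonneg fun v _ => ENNReal.toReal_nonneg]
        exact Finset.sum_congr rfl fun w _ =>
          (ENNReal.ofReal_sum_of_nonneg fun v _ => ENNReal.toReal_nonneg).symm
    _ ≤ _ :=
        ENNReal.ofReal_le_ofReal
          ((sum3_perc_S_eqOne_ge_ge_ge_toReal_le_slots p hd hp hM hx hR₁ hR₂ hR₃ _ _ _).trans
            (triangleSlotR_mono_count hp0 (1 + m₂) m₃ m₄ M hN R₁ R₂ R₃))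

end Letter

/-! ## E. The cell `(A^ι)_{0,2}` (endpoint `0`) -/

section Cells

variable (p : unitInterval)

/-- **`(A^ι)_{0,2}` by EXL-XSLOT (square, first bond exact)**:
`(A^ι)_{0,2} = Σ'_{x,y} Σ_κ (1−δ_{y,0})(1−δ_{x,0}) 𝓢_{1̲,0,2,1}(e_κ,x,y,0) ≤ ofReal (triangleSlotR p Γ̄₂ 1 2 1 M N₀ R₁ R₂ R₃)`
`= ofReal (Σ_{L=4}^{M−1} C(L−2,2) N₀(L) p^L + C(M−3,2) p^M Γ̄₂ R₁ + (M−4) p^M Γ̄₂² R₂ + p^M Γ̄₂³ R₃)` at the endpoint `0`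
(`N₀` majorises the closed trail-word counts, `R₁` valid for `[M]`, `R₂` for `[M−1, 1]`, `R₃` for `[M−3, 2, 1]` on
a set containing `0`; `4 ≤ M`) — the repulsive triangle shape at total index `4`, no `2d·p` prefactor, no peel: the
exact bond is the first slot of the trail (compare the P⁺ majorant `perc_matAiota_zero_two_le_peel`, `2d·p·triangleSlotR p Γ̄₂ 0 2 1 …`).
[cite: FitznerVanDerHofstad2017, App. B Table B.4 row (0,2) (arXiv:1506.07977v2 p. 74); (5.1) p. 49]
[cite: FitznerVanDerHofstad2016NoBLE, §5.3.2 (5.41) (PTRF 169 (2017) p. 1098)] -/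
theorem perc_matAiota_zero_two_le_xslot (hd : 2 ≤ d) (hp : p < criticalProbI d) {M : ℕ} (hM : 4 ≤ M)
    {X : Set (Site d)} (h0 : (0 : Site d) ∈ X) {N₀ : ℕ → ℕ}
    (hN : ∀ L, (trailWordsTo d L (0 : Site d)).card ≤ N₀ L) {R₁ R₂ R₃ : ℝ} (hR₁ : IsRemKernelConst d [M] X R₁)
    (hR₂ : IsRemKernelConst d [M - 1, 1] X R₂) (hR₃ : IsRemKernelConst d [M - 3, 2, 1] X R₃) :
    matAiota (Letters.perc d p) 0 2 ≤ ENNReal.ofReal (triangleSlotR p (nobleSup2 d p) 1 2 1 M N₀ R₁ R₂ R₃) := by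
  rw [matAiota_zero_two]
  refine le_trans (ENNReal.tsum_le_tsum fun x => ENNReal.tsum_le_tsum fun y => Finset.sum_le_sum fun κ _ => ?_)
    (tsum_tsum_sum_perc_S_eqOne_ge_ge_ge_stepVec_le_ofReal p hd hp (m₂ := 0) (m₃ := 2) (m₄ := 1) hM h0 hN
      hR₁ hR₂ hR₃)
  calc kdc y 0 * kdc x 0 * (Letters.perc d p).S (.eq 1) (.ge 0) (.ge 2) (.ge 1) (stepVec κ) x y 0
      ≤ 1 * 1 * (Letters.perc d p).S (.eq 1) (.ge 0) (.ge 2) (.ge 1) (stepVec κ) x y 0 := by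
        gcongr
        · exact kdc_le_one y 0
        · exact kdc_le_one x 0
    _ = _ := by rw [one_mul, one_mul]

end Cells

end Literature.Probability.FitznerVanDerHofstad2017.NobleBlocks
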